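import Mathlib.Geometry.Manifold.Instances.Sphere
import Mathlib.Analysis.SpecialFunctions.Complex.Circle
import Literature.Topology.FourManifolds.Trisections
import Literature.Topology.FourManifolds.ClosedBall
import Literature.Topology.FourManifolds.WeaklyReducibleTrisections
import Literature.Topology.FourManifolds.ConnectedSum
import Literature.Topology.FourManifolds.ConnectedSumSummands
import Literature.Topology.FourManifolds.SmoothOrientation
import Literature.AlgebraicTopology.FundamentalGroup.CircleValuedLift
import HarnessLib

/-!
# Reducible trisections split as connected sums (Aranda–Zupan 2025, §2; Meier–Schirmer–Zupan 2016, §3; Gay–Kirby 2016, §2)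

Topic `Literature/Topology/FourManifolds`, after `WeaklyReducibleTrisections.lean` (the
vocabulary `Trisection.IsCurve`, `Trisection.BoundsDisc`, `Trisection.IsNonSeparating`,
`Trisection.spineHandlebody`, `Trisection.centralSurfaceSet`, `Trisection.IsReducible` over the
tree's Gay–Kirby predicate `Literature.Topology.FourManifolds.IsGKTrisection X g k S`) and
`ConnectedSum.lean` (the relational connected sum `Literature.Topology.FourManifolds.IsConnectedSum`).

## What is printed

Aranda–Zupan, *Manifolds with weakly reducible genus-three trisections are standard*
(arXiv:2503.04607, 2025), §2, p. 6 (conventions p. 3: all manifolds smooth and orientable; a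
*curve* is an essential simple closed curve; a compressing disc is properly embedded):

> "As in the case of Heegaard splittings, a trisection is said to be *reducible* if there
> exists a curve `c` in `Σ` which is a compressing curve for all three of `H_α`, `H_β`, and
> `H_γ`, called a *reducing curve*. In this case, if `c` is separating, we can express `T` as a
> connected sum `T = T′ # T″`, where `X = X′ # X″` and `T′` and `T″` are trisections of `X′` and
> `X″`, respectively. If `c` is nonseparating, then a standard argument shows that
> `X = X′ # (S¹ × S³)`, and `T` can be decomposed as the connected sum of a trisection `T′` of
> `X′` and the standard genus-one trisection of `S¹ × S³`."

(§1, p. 2: "in this case, we can split `T` into a connected sum of smaller-genus trisections";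
the connected sum of trisections is Gay–Kirby, *Trisecting 4-manifolds* (2016), §2: the sum of
a `(g′; k′)`- and a `(g″; k″)`-trisection is a `(g′ + g″; k′ + k″)`-trisection; the standard
trisection of `S¹ × S³` has type `(1; 1, 1, 1)`.)

Where the proof is printed: Meier–Schirmer–Zupan, *Classification of trisections and the
Generalized Property R Conjecture*, Proc. AMS 144 (2016), §3 (arXiv:1507.06561 numbering).
Their Definition 3.4 is this notion ("reducible if there exists a curve `δ ⊂ Σ` such that `δ`
bounds disks `D_α`, `D_β`, and `D_γ` in `H_α`, `H_β`, and `H_γ`"); Proposition 3.5, "A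
trisection `T` is reducible if and only if `T` admits a trisected reducing sphere" (an embedded
three-sphere `S ⊂ X` with `S ∩ X_i` a three-ball for each `i` and `S ∩ Σ = δ` an essential
curve), is proved there: the 2-sphere `R₁ = D_α ∪ D_β ⊂ ∂X₁`, `X₁` a `0`-handle with `k₁`
`1`-handles, may meet the belt spheres of the `1`-handles, "but by [Laudenbach, *On the
2-spheres in a 3-manifold*, Bull. AMS 78 (1972)] we can isotope and handle slide the
`1`-handles over one another until their belt spheres are disjoint from `R₁`", so that `R₁` lies
in the boundary `S³` of the `0`-handle off the attaching regions and bounds a three-ball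
`B₁ ⊂ X₁`; likewise `B₂`, `B₃`, and `S = B₁ ∪ B₂ ∪ B₃`.  The splitting is then read off by
cutting along `S` and capping with (genus-`0`-trisected) 4-balls — proof of their
Proposition 3.9: "`δ` is a reducing curve on `Σ` that decomposes `T` into two trisections" —,
`S` separating `X` iff `δ` separates `Σ`.  So the printed argument rests on Laudenbach's theorem
on `2`-spheres in `#^k(S¹ × S²)` (Ann. of Math. 97 (1973)) and Alexander's theorem, not on
Cerf's `Γ₄ = 0`; Aranda–Zupan (§1, p. 2) and Gay–Kirby (§2) phrase the same splitting through
"a trisection is determined up to diffeomorphism by its spine", i.e. through the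
Laudenbach–Poénaru extension theorem (Bull. SMF 100 (1972)).

## How it is rendered here (relative to the tree's notions, D-0014)

Two NAMED FACTS, one per case, for a closed connected oriented smooth 4-manifold `X`
(`[CompactSpace X] [ConnectedSpace X]`, an explicit `SmoothOrientation (𝓡 4) X`, as in
`arandaZupan_genus_three_weaklyReducible_homotopySphere_gk`) with sectors
`S : Fin 3 → Set X`, `IsGKTrisection X g k S`, and a reducing curve `δ`: `Trisection.IsCurve S δ`,
`δ` essential in `Σ` (it bounds no smoothly embedded disc `𝔻² → X` with image in `Σ`, the
clause of `Trisection.IsReducible`), and `Trisection.BoundsDisc S (Trisection.spineHandlebody S q) δ`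
for all three `q`:

* `Trisection.isConnectedSum_of_reducing_separating` — if `Σ ∖ δ` is not connected
  (`¬ Trisection.IsNonSeparating S δ`): there are closed connected smooth 4-manifolds `X₁`, `X₂`
  (same universe as `X`, with their `TopologicalSpace … IsManifold` data existentially bound)
  carrying GK-trisections of types `(g₁; k₁)`, `(g₂; k₂)` with `g₁ + g₂ = g`,
  `k₁ i + k₂ i = k i`, `1 ≤ g₁`, `1 ≤ g₂`, and `IsConnectedSum (𝓡 4) (𝓡 4) (𝓡 4) X₁ X₂ X`
  (`X` is a connected sum `X₁ # X₂`).  The positivity of the genera is the only clause not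
  verbatim in the quotation: the central surfaces of `T′`, `T″` are the two sides of `δ` in `Σ`
  capped off by a disc, and a side of genus `0` would be a disc bounded by `δ` inside `Σ`,
  excluded since a curve is essential (p. 3) — it is exactly what "smaller-genus" (p. 2) says in
  the separating case.
* `Trisection.isConnectedSum_circleProd_of_reducing_nonseparating` — if `Σ ∖ δ` is connected:
  there is a closed connected smooth `X₁` with a GK-trisection of type `(g₁; k₁)`,
  `g₁ + 1 = g`, `k₁ i + 1 = k i` (no `ℕ`-subtraction), and
  `IsConnectedSum (𝓡 4) (𝓡 4) ((𝓡 1).prod (𝓡 3)) X₁ (Circle × 𝕊³) X`, with `S¹ × S³` rendered as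
  Mathlib's `Circle × 𝕊³` (model `(𝓡 1).prod (𝓡 3)`), as in `NonSeparatingSpheres.lean`.

The hypotheses are those of the printed sentence made explicit (the hypothesis `[CompactSpace X]`
is implied by the trisection, `IsGKTrisection.compactSpace`, and is kept for the closed-manifold
reading); nothing about uniqueness of the splitting, the position of the splitting 3-sphere, or
the trisection *diagram* is asserted.  Users take
`(h : Trisection.isConnectedSum_of_reducing_separating)` etc.

Nothing in this file is proved except the small consequences at the end (the essential reducing
curve forces `1 ≤ g`, read off from either fact; GIVEN the non-separating fact, a non-separating
reducing curve forces `π₁(X) ≠ 1`, so on a simply connected `X` every reducing curve separates).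

## Status of the non-separating fact (review against the sources, 2026-08-17)

`Trisection.isConnectedSum_circleProd_of_reducing_nonseparating` was re-read against Aranda–Zupan
(p. 6, quoted above) and Meier–Schirmer–Zupan (Prop. 3.5 with its proof) and is faithful as
stated: the types `(g − 1; k − 1)` are those of `T′` when `T = T′ # T_{S¹ × S³}` with the
standard `(1; 1, 1, 1)`-trisection of `S¹ × S³`, and `k i ≥ 1` is forced (the 2-sphere
`D_j ∪ D_l ⊂ ∂X_i ≅ #^{k_i}(S¹ × S²)` is non-separating when `δ` is).  It is NOT provable from
the present tree; the printed argument needs, and the tree lacks as theorems: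
(1) the 3-balls `B_i ⊂ X_i` bounded by the disc-spheres — Laudenbach's theorem on 2-spheres in
`#^k(S¹ × S²)` (MSZ's road) or the Laudenbach–Poénaru extension theorem, in the tree the named
fact `Literature.Topology.FourManifolds.exists_diffeomorph_comp_incl_eq` (`SPC4Handles.lean`;
reduced in `LaudenbachPoenaruPositiveGenus.lean` to three further named facts, among them Cerf's
`Γ₄ = 0`); (2) smoothing of the piecewise-smooth sphere `B₀ ∪ B₁ ∪ B₂` (corners along the discs
and along `δ`; `Trisection.BoundsDisc` does not even ask the discs to be neat along `δ`);
(3) cutting `X` along that sphere and capping with 4-balls, producing `X₁` and the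
`IsConnectedSum` witness (existence and uniqueness of connected sums are proved in the tree,
`exists_isConnectedSum_holds`, `nonempty_diffeomorph_of_isOrientedConnectedSum_holds`; a cutting
construction is not); (4) re-trisecting `X₁`, with the corner charts `IsCornerAt` of
`IsGKTrisection`, in types `(g − 1; k − 1)`.

What its two consumers (`Literature/Barriers/SmoothPoincare4/WeaklyReducibleGenusThreeStandard.lean`,
`Summits/SmoothPoincare4/SmoothPoincare4/Theorems/WeakReductionDescentReducibleSplits.lean`) use is
only its **`π₁`-shadow** — a closed 4-manifold with a GK-trisection and a non-separating reducing
curve is not simply connected (a summand of a simply connected sum is simply connected,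
`IsConnectedSum.simplyConnectedSpace_right`, while `π₁(S¹ × S³) ≠ 1`) — recorded below as the
proved corollary `Trisection.not_simplyConnectedSpace_of_reducing_nonseparating_of_fact`.  That
shadow has a road in the tree avoiding (1)–(4): the proved van Kampen theory of GK-trisections
((T1)–(T4): `TrisectionFunctorGKInputs.lean`, `TrisectionFunctorGKVanKampen.lean`) and the proved
assembly `IsGKTrisection.not_simplyConnectedSpace_of_circleMaps`
(`TrisectionFunctorGKPi1Obstruction.lean`, with `CircleValuedCollapse.lean` and
`CircleValuedWindingCrossing.lean` of `Literature/AlgebraicTopology/FundamentalGroup`); what it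
still needs is the collapse data — a normal coordinate of `δ` in `Σ`, normal coordinates of the
discs `D_q` in `H_q` restricting to it, and a dual loop in `Σ` crossing `δ` once.

## Review of the non-separating fact as a decomposition child (review seat, 2026-08-17)

`Trisection.isConnectedSum_circleProd_of_reducing_nonseparating` was minted as a decomposition
child of the route item `ReducibleSplits` of `SmoothPoincare4/WeakReductionDescent` (the second
consumer above), triaged XL by two prove seats, both of which parked on
`Literature.Topology.FourManifolds.exists_diffeomorph_comp_incl_eq`.  Verdict, taken with both
sources open (Aranda–Zupan p. 6, lines 4–10 of the page; Meier–Schirmer–Zupan §3, Def. 3.4,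
Prop. 3.5 with its proof, proof of Prop. 3.9):

* **Faithful, printed, not open; but mis-cut.**  The statement is the printed sentence with its
  hypotheses made explicit (§ Status); Aranda–Zupan state it as a standard result and MSZ print
  the reducing-sphere half of the argument, so there is no corrected statement to vendor.  As a
  child of `ReducibleSplits`, however, it asks for far more than any consumer uses: the
  re-trisection of `X₁` in type `(g − 1; k − 1)` and the `IsConnectedSum` witness — items (1)–(4)
  of § Status, a theory of its own — serve nobody; both consumers use only the `π₁`-shadow.
  Parking on `exists_diffeomorph_comp_incl_eq` was never a resolution: that fact is ONE of the
  four missing inputs and does not imply this one.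
* **Frozen as a record.**  The re-cut cannot be made on this declaration: both consumers
  destructure its exact `∃`-shape (`obtain ⟨X₁, …, hP⟩ := h …`) and the `Theorems` file among
  them is append-only, so the body can be neither changed (a meaning edit in place is forbidden
  anyway) nor removed; and the `π₁`-shadow may not be minted as a further named fact (D-0026).
  Hence the declaration stays VERBATIM as a record: NOT to be re-queued for a proof as stated,
  NOT to be parked on `exists_diffeomorph_comp_incl_eq` again.
* **Operative re-cut = the `π₁`-shadow, as a THEOREM** — the conclusion of
  `Trisection.not_simplyConnectedSpace_of_reducing_nonseparating_of_fact` below WITHOUT its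
  hypothesis `h₂`.  Its road is in the tree and avoids (1)–(4): (T4)
  `IsGKTrisection.surjective_inclHom_iInter_and_ker_eq` → the obstruction
  `IsGKTrisection.not_simplyConnectedSpace_of_hom_spineHandlebody` and the assemblies
  `…_of_circleMaps(_perturbed)` (`TrisectionFunctorGKPi1Obstruction.lean`) →
  `IsGKTrisection.not_simplyConnectedSpace_of_sideFunctions`
  (`ReducibleTrisectionNonSeparatingPi1.lean`, proved: locally constant `±1` side functions of
  three closed sets `D_q ⊆ H_q` with `D_q ∩ Σ = δ`, compatible on `Σ` near `δ`, and one crossing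
  arc in `Σ` give `¬ SimplyConnectedSpace X`, through the normal coordinates
  `σ_q · infDist(·, D_q)`, one cut-off, `circleCollapse`, and a return path in the path
  connected `Σ ∖ δ`).  What remains is differential topology only: the side functions of the
  three smoothly embedded compressing discs near their common boundary `δ` (two-sidedness of a
  disc in `H_q`, its trace on `Σ` being the two sides of `δ`; recall that `BoundsDisc` does not
  make the discs neat along `δ`) and a crossing arc in a chart of `Σ` straightening `δ`.
* **Retirement.**  When `Trisection.not_simplyConnectedSpace_of_reducing_nonseparating` lands
  as a theorem (hypotheses of the `_of_fact` corollary minus `h₂`), the consumers drop `h1b` /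
  `hns` in new theorems next to the present ones, this record loses its last user, and it is
  deleted together with the three corollaries below that mention it (of
  `IsReducible.one_le_genus_of_facts` only the separating half
  `two_le_genus_of_reducing_separating_of_fact` survives).  The separating-case fact
  `Trisection.isConnectedSum_of_reducing_separating` is NOT affected: its full strength
  (`X = X₁ # X₂` with trisections of genera `g₁ + g₂ = g`, `gᵢ ≥ 1`) is consumed.

## Status of the separating fact (prove seat, 2026-08-17)

`Trisection.isConnectedSum_of_reducing_separating` was re-read against the same pages
(Aranda–Zupan p. 6; Meier–Schirmer–Zupan §3, Def. 3.4, Prop. 3.5 with proof, proof of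
Prop. 3.9; Gay–Kirby §2) by its prove lineage: faithful as stated, printed, not open, consumed
at full strength (§ Review), and not YET proved in the tree — but (revised 2026-08-17, (P1′) below)
provable from theorems the tree already has, by a construction of the size of a theory; no
unproved named fact and no absent theorem of the literature stands in the way.  The printed
proof, step by step against the tree (what exists is named; "absent" means no theorem and no
named fact):

* (P1) *Standard 3-balls in the sectors.*  In `X_i ≅ ♮^{k_i}(S¹ × B³)` the disc-sphere
  `R_i = D_j ∪_δ D_l ⊂ ∂X_i` bounds a neat 3-ball `B_i` in STANDARD position — so that `X_i` cut
  along `B_i` is `♮^{a_i}(S¹ × B³) ⊔ ♮^{b_i}(S¹ × B³)` with `a_i + b_i = k_i`.  MSZ's printed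
  input, Laudenbach's normal form for 2-spheres in `#^k(S¹ × S²)` relative to the belt spheres
  (after handle slides `R_i` lies in the boundary of the `0`-handle off the `1`-handles), is
  absent; so is the input of the hybrid alternative (identify the capped sides of `R_i` in
  `∂X_i ≅ #^{k_i}(S¹ × S²)` as `#^{a_i}`, `#^{b_i}(S¹ × S²)` by Milnor's uniqueness of the prime
  decomposition — `KneserMilnorRetract.lean` is conditional on a prime decomposition,
  `diffeomorph_sumS1S2_of_isFreeOfRank_fundamentalGroup` is of Perelman strength —, realise
  the boundary identification by `laudenbachPoenaru_exists_diffeoExtends_mapOfEq_eq_holds` and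
  extend it over the sector by the unproved named fact `laudenbachPoenaru_thmA_model_succ` of
  `LaudenbachPoenaruPositiveGenus.lean`; the umbrella `exists_diffeomorph_comp_incl_eq` = that
  fact + Cerf's `Γ₄ = 0` belongs to the pure spine road only).  Standard position cannot be
  weakened to MSZ's "`S ∩ X_i` is a 3-ball" as the interface to (P4)–(P5): for an ARBITRARY
  neat 3-ball the cut pieces are recognised only through Milnor's uniqueness at the boundary
  and, already at `k_i = 0`, the smooth 4-dimensional Schoenflies problem.
* (P1′) *Standard 3-balls WITHOUT a sphere theorem* (prove seat, 2026-08-17; an elementary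
  handlebody argument, not in the three sources, to be refereed before a route is built on
  it).  Neither input of (P1) is needed, because the ball may be CHOSEN.  Present the sector
  (clause (ii) model `W`, `HasHandleDecomposition 3 W (handleCount 1 k)`, compared with an
  explicit model by UNIQ₄ = `nonempty_diffeomorph_of_hasHandleDecomposition_handleCount_one_holds`)
  as `Z = Z_core ∪ ⋃ⱼ hⱼ`, `Z_core ≅ 𝔻⁴`, `hⱼ = [−η, η] × D³` glued along `{±η} × D³ ⊂ ∂Z_core`,
  where the belt slabs are taken at REGULAR values of the handle coordinate restricted to the
  smooth sphere `R ⊂ ∂Z` (Sard; no isotopy of `R`), so that `R ∩ ∂hⱼ = [−η, η] × Cⱼ` for finite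
  unions of circles `Cⱼ ⊂ S²` (`m` circles in all).  Fill them through the handles by product
  discs `[−η, η] × F_c`, `F_c ⊂ D³` disjoint neat discs over the laminar disc sides of the
  circles (`SphereCircleSplitting.exists_two_discs_sphere`, proved, pushed radially into the
  ball); the planar remainder of `R` in `∂Z_core ≅ S³`, capped by the `2m` face discs
  `{±η} × F_c`, is `R` surgered along the `m` circles: `m + 1` disjoint 2-spheres
  (`χ = 2 + 2m`, at most `m + 1` components), each bounding a ball in `S³` by Alexander's theorem
  (`SphereEmbedding.schoenflies_exists_ball_holds`, proved), the balls laminar, pushed to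
  disjoint neat 3-balls `B_t ⊂ Z_core` at nesting depths.  `B := ⋃ B_t ∪ ⋃ [−η, η] × F_c`
  (tube ends tapered and bent by a flat function) is neat with `∂B = R`, and is a BALL: the
  `m + 1` balls and `m` solid tubes form a connected graph with `m` edges, a tree.  Cutting:
  `Z_core ∖ ⋃ B_t` is `m + 2` four-balls, `hⱼ ∖ tubes` is `|Cⱼ| + 1` one-handle strands, so
  `Z` cut along `B` is `(m + 2)` `0`-handles and `(m + k)` `1`-handles on a graph which has two
  components when `R` separates `∂Z` (parity of crossings, as in (P3)), of cycle ranks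
  `a + b = (m + k) − (m + 2) + 2 = k`; the two closures are `(1, a)`-, `(1, b)`-handlebodies by
  handle-attachment Morse gluing (`AttachData.isMorseAdapted_desc`,
  `AttachData.exists_isHandlebodyOfIndexLE_of_isMorseFunction`), NORM =
  `exists_hasHandleDecomposition_handleCount_one_holds` and an Euler-characteristic count (or a
  stage built along a spanning tree, `OneHandlebodyStage`).  Nothing classifies `R` up to
  isotopy — which is exactly what cutting does not need, and why Laudenbach, Laudenbach–Poénaru,
  Kneser–Milnor and Cerf all drop out.  The same construction one dimension down RE-CHOOSES the
  compressing discs: in the model of `H_q` (`HasHandleDecomposition 2 H (handleCount 1 g)`,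
  `IsHandlebody.nonempty_diffeomorph_of_oneHandle oneHandle_nonempty_diffeomorph_holds`) take
  regular belt slabs for the handle coordinate on `δ` and on the given `D_q`, pair the points of
  `δ` on each belt circle by the arcs in which `D_q` meets the belt disc, put bands
  `[−η, η] × arc` (arcs re-drawn radial at their ends, same pairing) through the handles and
  pushed discs under the resulting
  `m′ + 1` circles of `∂(0-handle) ≅ S²`: a neat disc `D_q′` with `∂D_q′ = δ`, radial
  (corner-straight) near `δ`, along which `H_q` is cut into `(m′ + 2)` balls and `(m′ + g)`
  strands, i.e. into two handlebodies of genera `g₁ + g₂ = g`, `gᵢ ≥ 1` (a genus-`0` side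
  would make the closure of a side of `δ` in `Σ` a smooth disc) — replacing the absent "cutting
  a handlebody along a separating meridian disc" of (P5)–(P6) and the neat re-choice of the
  `BoundsDisc` discs.  What (P1′) costs is constructions only: regular slabs and product
  structure near a regular level (Sard, flow collars as in `RegularLevelCollar.lean`), pushed
  discs/balls with radial rims, parametrising the capped sphere pieces by `𝕊²` for Alexander
  (the pattern of the Schoenflies seat's `StepDiscs.lean` / `SubsphereParam.lean`), the explicit
  models with their belt slabs, "a tree of balls is a ball", the cutting count, and the
  orientability of the clause-(ii)/(iii) models from the orientation of `X`.
* (P2) *The reducing sphere as a neck.*  `S = B₀ ∪ B₁ ∪ B₂` (three balls around the binding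
  `δ`, pairwise meeting in the `D_q`) smoothed — corners along the `D_q` and along `δ` — into a
  smoothly embedded `S³` with a product neighbourhood adapted to the strata, i.e. a neck
  `ψ : S³ × ℝ ↪ X` with `ψ⁻¹(X_i) = (i-th wedge) × ℝ`.  PROVED in regular-level form
  (2026-08-17, `RegularLevelSphereConnectedSum.lean`): once `S` is exhibited as a regular level
  `σ⁻¹(0)` of a smooth `σ : X → ℝ` (`IsRegularLevel (𝓡 4) σ 0`) and as the range of a smooth
  embedding `e : S³ ↪ X`, the flow of a unit-speed field across the level gives the neck
  (`LevelUnitField.sphereNeck`, with `σ ∘ ψ (θ, t) = squash δ t`, `ψ (θ, 0) = e θ`), the two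
  sides `{σ > 0}`, `{σ < 0}` as `NeckCapData 3 ψ` for `ψ` and its flip
  (`LevelUnitField.upperCap` / `lowerCap`) — which is the 4-dimensional part of (P3) —, and
  (P4) outright (`LevelUnitField.isConnectedSum_capped`:
  `IsConnectedSum (𝓡 4) (𝓡 4) (𝓡 4) X₊ X₋ X` for the capped sides, closed and connected;
  packaged as `IsRegularLevel.exists_isConnectedSum_of_sphere_level`).  What remains of (P2) is
  to produce `σ` and `e` from the balls of (P1′), with `S` smooth across the `D_q′` and `δ`
  (corner-straight discs, matching collars of the `H_q`) and the unit field tangent to the `H_q`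
  near `S` (so that the neck is adapted, `ψ⁻¹(X_i) = wedge × ℝ`): absent.
* (P3) *Separation.*  `δ` separates `Σ` ⇒ `D_q` separates `H_q` ⇒ `R_i` separates `∂X_i` ⇒ the
  middle sphere of `ψ` separates `X`, after which `exists_two_sides_of_neck_of_not_isPreconnected`
  (`NeckSeparation.lean`, proved) gives the two sides.  PROVED up to dimension 3 (2026-08-17),
  unconditionally and compatibly across the strata: `Σ ∖ δ = Σ₁ ⊔ Σ₂`
  (`IsGKTrisection.exists_two_sides_of_not_isNonSeparating'`, `TrisectionCurveFlatCharts.lean`,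
  over `ReducibleTrisectionSeparatingSides.lean`); `H_q ∖ D_q = U₁ ⊔ U₂` with `Σᵢ ⊆ Uᵢ`
  (`IsGKTrisection.exists_two_sides_spineHandlebody_diff_range`,
  `ReducibleTrisectionSeparatingDiscSides.lean`; the separation itself,
  `IsGKTrisection.not_isConnected_spineHandlebody_diff_range`, is the circle-valued winding
  argument of `ReducibleTrisectionSeparatingDisc.lean` over the two-sidedness of the disc,
  `IsGKTrisection.exists_sideFunction_of_disc` / `exists_isLocalSide_of_disc` — the local
  structure shared with the operative non-separating theorem, § Review); and
  `∂X_i ∖ R_i = V₁ ⊔ V₂` with `Vᵢ ∩ Σ = Σᵢ`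
  (`IsGKTrisection.exists_two_sides_union_spineHandlebody_diff`,
  `∂X_i = H_j ∪ H_l` by `Trisection.spineHandlebody_succ_union_spineHandlebody_succ_succ`).  The
  4-dimensional step (the sides of `B_i` in `X_i`, of `S` in `X`) needs the balls of (P1); in the
  regular-level form of (P2) it is free (the sides are `{σ > 0}`, `{σ < 0}`), and the
  3-dimensional statements above are what pins which side contains `Σ₁`.
* (P4) *Cut and cap.*  PROVED: for two `NeckCapData` sides of `ψ`, disjoint and covering `X` off
  the middle sphere, `NeckCapData.isConnectedSum_capped` (`NeckCapping.lean`) is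
  `IsConnectedSum 𝓘(ℝ, 𝔼4) 𝓘(ℝ, 𝔼4) 𝓘(ℝ, 𝔼4) X₁ X₂ X` for the capped sides (`𝓡 4` is
  `𝓘(ℝ, 𝔼 4)`), which are Hausdorff, compact, smooth and — `NeckCapData.connectedSpace_capped_left`
  / `_right` (`NeckCapTransport.lean`, stated in `Type`) — connected; the fact is universe-free
  (`isConnectedSum_of_reducing_separating_of_univ`, `ReducibleTrisectionSplittingUniv.lean`), so
  a proof may cut in `Type` and transport, and GK-trisections move along diffeomorphisms
  (`IsGKTrisection.preimage_diffeomorph`, `TrisectionShrink.lean`).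
* (P5) *Re-trisecting the capped sides* in types `(g₁; a)`, `(g₂; b)` (MSZ, proof of Prop. 3.9;
  Gay–Kirby §2 read backwards): sectors `closure (X_i ∩ side) ∪` (i-th wedge of the capping
  4-ball with its genus-`0` trisection); clause (ii) of `IsGKTrisection` for them
  (`HasHandleDecomposition` models, `IsCornerAt` charts along the new central surface
  `closure (Σ ∩ side) ∪ disc`); clause (iii) (the cut handlebodies `closure (H_q ∩ side) ∪`
  half-disc are genus-`g₁` handlebodies: by the 3-dimensional half of (P1′) once the discs are
  re-chosen; for arbitrary discs it would be the absent "cutting a handlebody along a separating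
  meridian disc"): absent — a construction of the size of the tree's stabilisation of
  GK-trisections (`TrisectionStabilization*`, `TrisectionsImplant*`, `TrisectionsSector*`; the
  ambient route is `IsGKTrisection.exists_triNormalForm` → implant → `sectorClause_of_ambient` /
  `isGKTrisection_of_triNormalForm`; near the cap point the new sectors are linear cones, the
  corner model itself, once `e : S³ ≅ S` is standard on the three wedges).
* (P6) *Bookkeeping.*  `g₁ + g₂ = g`, `a_i + b_i = k_i`, `1 ≤ g₁, g₂`: all read off the
  cutting counts of (P1′) (for arbitrary discs, `1 ≤ gᵢ` would be the smooth 2-dimensional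
  Schoenflies theorem on `Σ`); `χ(X) = 2 + g − Σ kᵢ`
  (`finRelHomology_and_relEuler_of_isGKTrisection`) is a free consistency check.

So (P4), all transport, (P3) up to dimension 3, and — given the reducing sphere as a regular
level `σ⁻¹(0) ≅ S³` — the neck, the 4-dimensional sides and the connected-sum witness of
(P2)–(P4) are in the tree; (P1′), the production of `σ` and `e` in (P2), (P5) and (P6) are not,
and none of them is a slice of this fact that could be stated without new vocabulary for the
balls and the cut pieces.  Since (P1′) NO unproved named fact is on the road any more (in
particular not `laudenbachPoenaru_thmA_model_succ`, on which this fact's seats were parked until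
2026-08-17, nor `exists_diffeomorph_comp_incl_eq`): what is missing are constructions over proved
theorems, being landed bottom-up as sorry-free files of this topic by the fact's prove seat; a
planner who needs the consuming route item proved sooner should carry (P1′), (P2) and (P5) as
route cruxes — they are debt-free.

## References

* R. Aranda, A. Zupan, *Manifolds with weakly reducible genus-three trisections are standard*,
  arXiv:2503.04607 (2025), §1 p. 2, §2 pp. 3, 6. [ArandaZupan2025]
* D. Gay, R. Kirby, *Trisecting 4-manifolds*, Geom. Topol. 20 (2016) 3097–3132, Def. 1, §2
  (connected sum and stabilisation of trisections). [GayKirby2016]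
* J. Meier, T. Schirmer, A. Zupan, *Classification of trisections and the Generalized Property
  R Conjecture*, Proc. AMS 144 (2016) 4983–4997 (arXiv:1507.06561), §3: Definition 3.4
  (reducible trisection, reducing curve), Proposition 3.5 with proof (trisected reducing
  sphere), proof of Proposition 3.9 (the reducing curve decomposes `T` into two trisections).
  [MeierSchirmerZupan2016]
* F. Laudenbach, *On the 2-spheres in a 3-manifold*, Bull. AMS 78 (1972) 792–795; *Sur les
  2-sphères d'une variété de dimension 3*, Ann. of Math. 97 (1973) 57–81, §5 (the input of
  MSZ's proof of Prop. 3.5). [Laudenbach1973]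
* F. Laudenbach, V. Poénaru, *A note on 4-dimensional handlebodies*, Bull. SMF 100 (1972)
  (extension of diffeomorphisms of `#^k(S¹ × S²)` over `♮^k(S¹ × B³)`: "a trisection is
  determined by its spine", the road indicated by Aranda–Zupan §1 and Gay–Kirby §2).
-/

noncomputable section

open scoped Manifold ContDiff Topology
open Set

namespace Literature.Topology.FourManifolds

universe u

/-- Local notation: `𝔼 n` is the model Euclidean space `EuclideanSpace ℝ (Fin n)`. -/
local notation "𝔼 " n:arg => EuclideanSpace ℝ (Fin n)

/-- Local notation: `𝕊 n` is the unit sphere in `EuclideanSpace ℝ (Fin (n + 1))`. -/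
local notation "𝕊 " n:arg => (Metric.sphere (0 : EuclideanSpace ℝ (Fin (n + 1))) 1)

/-- Local notation: `𝔻 n` is the closed unit ball in `EuclideanSpace ℝ (Fin n)` (a manifold with
boundary, `ClosedBall.lean`). -/
local notation "𝔻 " n:arg => (Metric.closedBall (0 : EuclideanSpace ℝ (Fin n)) 1)

namespace Trisection

/-- **Reducible trisections with a separating reducing curve split as connected sums** (named
fact).  Let `X` be a closed connected oriented smooth 4-manifold with a `(g; k 0, k 1, k 2)`-
trisection `S` (`IsGKTrisection X g k S`), central surface `Σ = ⋂ l, S l`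
(`centralSurfaceSet S`) and handlebodies `H_q = ⋂ (l ≠ q), S l` (`spineHandlebody S q`), and
let `δ ⊆ Σ` be a *reducing curve*: a smoothly embedded circle on `Σ` (`IsCurve S δ`), essential
in `Σ` (no smoothly embedded disc `𝔻² → X` with image in `Σ` has boundary circle `δ`), bounding
a properly embedded smooth disc in each of the three handlebodies (`BoundsDisc S (H_q) δ`).
Printed (Aranda–Zupan 2025, §2, p. 6): "In this case, if `c` is separating, we can express `T`
as a connected sum `T = T′ # T″`, where `X = X′ # X″` and `T′` and `T″` are trisections of `X′`
and `X″`, respectively" (connected sum of trisections: `(g′; k′) # (g″; k″) = (g′ + g″; k′ + k″)`,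
Gay–Kirby 2016, §2).  Rendered: if `Σ ∖ δ` is NOT connected, there are closed connected smooth
4-manifolds `X₁`, `X₂` (universe of `X`) with GK-trisections of types `(g₁; k₁)`, `(g₂; k₂)`,
`g₁ + g₂ = g`, `k₁ i + k₂ i = k i`, `1 ≤ g₁`, `1 ≤ g₂` (the central surfaces of `T′`, `T″` are
the two sides of the essential separating curve `δ`, capped off by a disc, hence of positive
genus — "smaller-genus trisections", §1 p. 2), such that `X` is a connected sum `X₁ # X₂`
(`IsConnectedSum (𝓡 4) (𝓡 4) (𝓡 4) X₁ X₂ X`).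
The printed proof is Meier–Schirmer–Zupan's (Prop. 3.5: a reducing curve yields a *trisected
reducing sphere* `S ≅ S³ ⊂ X`, `S ∩ X_i` a 3-ball, `S ∩ Σ = δ`, by Laudenbach's theorem on
2-spheres in `#^k(S¹ × S²)` applied in each `∂X_i`; proof of Prop. 3.9: `δ` "decomposes `T`
into two trisections", by cutting along `S` and capping); see the module docstring.
Users take `(h : Trisection.isConnectedSum_of_reducing_separating)`.
[cite: ArandaZupan2025, §2 p. 6 (reducing curves, separating case); §1 p. 2]
[cite: MeierSchirmerZupan2016, §3: Definition 3.4, Proposition 3.5 (with proof) and proof of Proposition 3.9]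
[cite: Laudenbach1973, §5 (the input of MSZ's proof of Prop. 3.5)] -/
def isConnectedSum_of_reducing_separating : Prop :=
  ∀ (X : Type u) [TopologicalSpace X] [T2Space X] [SecondCountableTopology X]
    [ChartedSpace (𝔼 4) X] [IsManifold (𝓡 4) ∞ X] [CompactSpace X] [ConnectedSpace X]
    (_ : SmoothOrientation (𝓡 4) X) (g : ℕ) (k : Fin 3 → ℕ) (S : Fin 3 → Set X) (δ : Set X),
    IsGKTrisection X g k S → IsCurve S δ →
    ¬ (∃ e : 𝔻 2 → X, Manifold.IsSmoothEmbedding (𝓡∂ 2) (𝓡 4) ∞ e ∧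
        range e ⊆ centralSurfaceSet S ∧ e '' (𝓡∂ 2).boundary (𝔻 2) = δ) →
    (∀ q : Fin 3, BoundsDisc S (spineHandlebody S q) δ) →
    ¬ IsNonSeparating S δ →
    ∃ (X₁ : Type u) (_ : TopologicalSpace X₁) (_ : T2Space X₁) (_ : SecondCountableTopology X₁)
      (_ : ChartedSpace (𝔼 4) X₁) (_ : IsManifold (𝓡 4) ∞ X₁) (_ : CompactSpace X₁)
      (_ : ConnectedSpace X₁)
      (X₂ : Type u) (_ : TopologicalSpace X₂) (_ : T2Space X₂) (_ : SecondCountableTopology X₂)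
      (_ : ChartedSpace (𝔼 4) X₂) (_ : IsManifold (𝓡 4) ∞ X₂) (_ : CompactSpace X₂)
      (_ : ConnectedSpace X₂)
      (g₁ g₂ : ℕ) (k₁ k₂ : Fin 3 → ℕ) (S₁ : Fin 3 → Set X₁) (S₂ : Fin 3 → Set X₂),
      IsGKTrisection X₁ g₁ k₁ S₁ ∧ IsGKTrisection X₂ g₂ k₂ S₂ ∧
      g₁ + g₂ = g ∧ 1 ≤ g₁ ∧ 1 ≤ g₂ ∧ (∀ i, k₁ i + k₂ i = k i) ∧
      IsConnectedSum (𝓡 4) (𝓡 4) (𝓡 4) X₁ X₂ X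

/-- **Reducible trisections with a non-separating reducing curve split off `S¹ × S³`** (named
fact).  Same setting as `Trisection.isConnectedSum_of_reducing_separating`: a closed connected
oriented smooth 4-manifold `X` with a `(g; k)`-trisection `S` and a reducing curve `δ` on the
central surface `Σ` (an essential smoothly embedded circle bounding properly embedded discs in
all three handlebodies of the spine).  Printed (Aranda–Zupan 2025, §2, p. 6): "If `c` is
nonseparating, then a standard argument shows that `X = X′ # (S¹ × S³)`, and `T` can be
decomposed as the connected sum of a trisection `T′` of `X′` and the standard genus-one
trisection of `S¹ × S³`" (the latter is the `(1; 1, 1, 1)`-trisection, so `T′` has type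
`(g − 1; k − 1)`).  Rendered: if `Σ ∖ δ` IS connected (`IsNonSeparating S δ`), there is a closed
connected smooth 4-manifold `X₁` (universe of `X`) with a GK-trisection of type `(g₁; k₁)`,
`g₁ + 1 = g` and `k₁ i + 1 = k i` for all `i`, such that `X` is a connected sum `X₁ # (S¹ × S³)`:
`IsConnectedSum (𝓡 4) (𝓡 4) ((𝓡 1).prod (𝓡 3)) X₁ (Circle × 𝕊³) X`, with `S¹ × S³` rendered as
Mathlib's `Circle × 𝕊³` (model `(𝓡 1).prod (𝓡 3)`, as in `NonSeparatingSpheres.lean`).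
The printed input is Meier–Schirmer–Zupan's Prop. 3.5 (a reducing curve yields a *trisected
reducing sphere* `S ≅ S³ ⊂ X`, `S ∩ X_i` a 3-ball, `S ∩ Σ = δ`, by Laudenbach's theorem on
2-spheres in `#^k(S¹ × S²)` applied in each `∂X_i`); `S` is non-separating in `X` when `δ` is
non-separating in `Σ`, and the "standard argument" cuts `X` along `S` and caps with two
(genus-`0`-trisected) 4-balls.  What a proof needs from the tree, and the `π₁`-shadow actually
used by the consumers (`not_simplyConnectedSpace_of_reducing_nonseparating_of_fact`), are listed
in the module docstring (§ Status).
**Review 2026-08-17 (module docstring, § Review): a faithful RECORD, frozen.**  As a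
decomposition child this statement is mis-cut — its consumers use only the `π₁`-shadow, whose
in-tree road ends at present in `IsGKTrisection.not_simplyConnectedSpace_of_sideFunctions`
(`ReducibleTrisectionNonSeparatingPi1.lean`) — but its `∃`-shape is pinned by those consumers,
so it is kept verbatim; it is not to be attempted as stated nor parked on
`exists_diffeomorph_comp_incl_eq`, and it is retired once the theorem
`Trisection.not_simplyConnectedSpace_of_reducing_nonseparating` lands and the consumers migrate.
Users take `(h : Trisection.isConnectedSum_circleProd_of_reducing_nonseparating)`.
[cite: ArandaZupan2025, §2 p. 6 (reducing curves, non-separating case)]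
[cite: MeierSchirmerZupan2016, §3: Definition 3.4 and Proposition 3.5 (with proof)] -/
def isConnectedSum_circleProd_of_reducing_nonseparating : Prop :=
  ∀ (X : Type u) [TopologicalSpace X] [T2Space X] [SecondCountableTopology X]
    [ChartedSpace (𝔼 4) X] [IsManifold (𝓡 4) ∞ X] [CompactSpace X] [ConnectedSpace X]
    (_ : SmoothOrientation (𝓡 4) X) (g : ℕ) (k : Fin 3 → ℕ) (S : Fin 3 → Set X) (δ : Set X),
    IsGKTrisection X g k S → IsCurve S δ →
    ¬ (∃ e : 𝔻 2 → X, Manifold.IsSmoothEmbedding (𝓡∂ 2) (𝓡 4) ∞ e ∧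
        range e ⊆ centralSurfaceSet S ∧ e '' (𝓡∂ 2).boundary (𝔻 2) = δ) →
    (∀ q : Fin 3, BoundsDisc S (spineHandlebody S q) δ) →
    IsNonSeparating S δ →
    ∃ (X₁ : Type u) (_ : TopologicalSpace X₁) (_ : T2Space X₁) (_ : SecondCountableTopology X₁)
      (_ : ChartedSpace (𝔼 4) X₁) (_ : IsManifold (𝓡 4) ∞ X₁) (_ : CompactSpace X₁)
      (_ : ConnectedSpace X₁)
      (g₁ : ℕ) (k₁ : Fin 3 → ℕ) (S₁ : Fin 3 → Set X₁),
      IsGKTrisection X₁ g₁ k₁ S₁ ∧ g₁ + 1 = g ∧ (∀ i, k₁ i + 1 = k i) ∧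
      IsConnectedSum (𝓡 4) (𝓡 4) ((𝓡 1).prod (𝓡 3)) X₁ (Circle × (𝕊 3)) X

/-! ### Small proved consequences -/

variable {X : Type u} [TopologicalSpace X] [T2Space X] [SecondCountableTopology X]
  [ChartedSpace (𝔼 4) X] [IsManifold (𝓡 4) ∞ X] [CompactSpace X] [ConnectedSpace X]

/-- GIVEN both splitting facts, a reducible trisection (`Trisection.IsReducible`: some essential
curve compresses in all three handlebodies) of a closed connected oriented 4-manifold has genus
`g ≥ 1` (in either case the genus is a sum with a positive summand). [folklore] -/
theorem IsReducible.one_le_genus_of_facts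
    (h₁ : isConnectedSum_of_reducing_separating.{u})
    (h₂ : isConnectedSum_circleProd_of_reducing_nonseparating.{u})
    (o : SmoothOrientation (𝓡 4) X) {g : ℕ} {k : Fin 3 → ℕ} {S : Fin 3 → Set X}
    (hS : IsGKTrisection X g k S) (hred : IsReducible S) : 1 ≤ g := by
  obtain ⟨δ, hc, hess, hd⟩ := hred
  by_cases hsep : IsNonSeparating S δ
  · obtain ⟨X₁, _, _, _, _, _, _, _, g₁, k₁, S₁, -, hg, -⟩ := h₂ X o g k S δ hS hc hess hd hsep
    omega
  · obtain ⟨X₁, _, _, _, _, _, _, _, X₂, _, _, _, _, _, _, _, g₁, g₂, k₁, k₂, S₁, S₂, -, -, hg,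
      hg₁, -, -⟩ := h₁ X o g k S δ hS hc hess hd hsep
    omega

/-- GIVEN the separating-case fact, a trisection with a SEPARATING reducing curve has genus
`g ≥ 2` (`g = g₁ + g₂` with `g₁, g₂ ≥ 1`). [folklore] -/
theorem two_le_genus_of_reducing_separating_of_fact
    (h₁ : isConnectedSum_of_reducing_separating.{u})
    (o : SmoothOrientation (𝓡 4) X) {g : ℕ} {k : Fin 3 → ℕ} {S : Fin 3 → Set X} {δ : Set X}
    (hS : IsGKTrisection X g k S) (hc : IsCurve S δ)
    (hess : ¬ (∃ e : 𝔻 2 → X, Manifold.IsSmoothEmbedding (𝓡∂ 2) (𝓡 4) ∞ e ∧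
        range e ⊆ centralSurfaceSet S ∧ e '' (𝓡∂ 2).boundary (𝔻 2) = δ))
    (hd : ∀ q : Fin 3, BoundsDisc S (spineHandlebody S q) δ) (hsep : ¬ IsNonSeparating S δ) :
    2 ≤ g := by
  obtain ⟨X₁, _, _, _, _, _, _, _, X₂, _, _, _, _, _, _, _, g₁, g₂, k₁, k₂, S₁, S₂, -, -, hg,
    hg₁, hg₂, -⟩ := h₁ X o g k S δ hS hc hess hd hsep
  omega

/-- **The `π₁`-shadow of the non-separating splitting, GIVEN the fact.**  If reducible
trisections with a non-separating reducing curve split off `S¹ × S³` as printed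
(`isConnectedSum_circleProd_of_reducing_nonseparating`), then a closed connected oriented smooth
4-manifold `X` carrying a GK-trisection with a NON-SEPARATING reducing curve `δ` (essential,
compressing in all three handlebodies of the spine) is not simply connected: `S¹ × S³` would be a
summand of the simply connected `X`, hence simply connected
(`IsConnectedSum.simplyConnectedSpace_right`, Kosinski VI §2), whereas `π₁(S¹ × S³) ≠ 1` — read
the circle coordinate in `ℝ/2πℤ` (`AddCircle.homeomorphCircle'`): the loop `t ↦ (2πt mod 2π, q₀)`
carries the non-closing real lift `t ↦ 2πt`, which a simply connected space forbids
(`Literature.AlgebraicTopology.FundamentalGroup.AddCircle.not_simplyConnectedSpace_of_lift`,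
Hatcher Prop. 1.30 with Thm. 1.7; the same computation as
`Literature.Barriers.SmoothPoincare4.not_simplyConnectedSpace_circle_prod_sphereThree`, which
lives downstream of this file).  This is the only consequence of the fact its consumers use
(module docstring, § Status), in their exact binder shape.
[cite: ArandaZupan2025, §2 p. 6 (reducing curves, non-separating case)]
[cite: Kosinski1993, Ch. VI §2, Prop. 2.1 and the preceding paragraph (p. 91)]
[cite: HatcherAT2002, Thm. 1.7 and Prop. 1.30] -/
theorem not_simplyConnectedSpace_of_reducing_nonseparating_of_fact
    (h₂ : isConnectedSum_circleProd_of_reducing_nonseparating.{u})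
    (o : SmoothOrientation (𝓡 4) X) {g : ℕ} {k : Fin 3 → ℕ} {S : Fin 3 → Set X} {δ : Set X}
    (hS : IsGKTrisection X g k S) (hc : IsCurve S δ)
    (hess : ¬ (∃ e : 𝔻 2 → X, Manifold.IsSmoothEmbedding (𝓡∂ 2) (𝓡 4) ∞ e ∧
        range e ⊆ centralSurfaceSet S ∧ e '' (𝓡∂ 2).boundary (𝔻 2) = δ))
    (hd : ∀ q : Fin 3, BoundsDisc S (spineHandlebody S q) δ) (hsep : IsNonSeparating S δ) :
    ¬ SimplyConnectedSpace X := by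
  intro hsc
  obtain ⟨X₁, _, _, _, _, _, _, _, g₁, k₁, S₁, -, -, -, hP⟩ := h₂ X o g k S δ hS hc hess hd hsep
  have h4 : 1 < Module.finrank ℝ (𝔼 4) := by
    rw [finrank_euclideanSpace_fin]; norm_num
  -- `S¹ × S³` would be simply connected as a summand of the simply connected `X`
  haveI : SimplyConnectedSpace (Circle × (𝕊 3)) := hP.simplyConnectedSpace_right h4
  -- but the circle coordinate has a loop with a non-closing real lift
  let q₀ : 𝕊 3 := ⟨EuclideanSpace.single 0 1, by simp⟩
  let e : (AddCircle (2 * Real.pi) × (𝕊 3)) ≃ₜ (Circle × (𝕊 3)) :=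
    Homeomorph.prodCongr AddCircle.homeomorphCircle' (Homeomorph.refl _)
  haveI : SimplyConnectedSpace (AddCircle (2 * Real.pi) × (𝕊 3)) :=
    e.toHomotopyEquiv.simplyConnectedSpace
  let f : C(AddCircle (2 * Real.pi) × (𝕊 3), AddCircle (2 * Real.pi)) :=
    ⟨Prod.fst, continuous_fst⟩
  let γ : Path (((0 : ℝ) : AddCircle (2 * Real.pi)), q₀)
      (((0 : ℝ) : AddCircle (2 * Real.pi)), q₀) :=
    { toFun := fun t => ((((t : ℝ) * (2 * Real.pi) : ℝ) : AddCircle (2 * Real.pi)), q₀)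
      continuous_toFun := by fun_prop
      source' := by simp
      target' := by simp }
  exact Literature.AlgebraicTopology.FundamentalGroup.AddCircle.not_simplyConnectedSpace_of_lift
    f γ (G := fun t => (t : ℝ) * (2 * Real.pi)) (by fun_prop) (fun _ => rfl)
    (by simp [Real.pi_ne_zero]) inferInstance

/-- GIVEN the non-separating fact: on a SIMPLY CONNECTED closed oriented 4-manifold (e.g. a
homotopy 4-sphere) every reducing curve of a GK-trisection separates the central surface — the
form in which the consumers use the fact (they then continue with the separating case).
[cite: ArandaZupan2025, §2 p. 6 and §6 p. 20 (reducible case of the proof of Thm. 1.3)] -/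
theorem not_isNonSeparating_of_reducing_of_simplyConnected_of_fact
    (h₂ : isConnectedSum_circleProd_of_reducing_nonseparating.{u}) [SimplyConnectedSpace X]
    (o : SmoothOrientation (𝓡 4) X) {g : ℕ} {k : Fin 3 → ℕ} {S : Fin 3 → Set X} {δ : Set X}
    (hS : IsGKTrisection X g k S) (hc : IsCurve S δ)
    (hess : ¬ (∃ e : 𝔻 2 → X, Manifold.IsSmoothEmbedding (𝓡∂ 2) (𝓡 4) ∞ e ∧
        range e ⊆ centralSurfaceSet S ∧ e '' (𝓡∂ 2).boundary (𝔻 2) = δ))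
    (hd : ∀ q : Fin 3, BoundsDisc S (spineHandlebody S q) δ) : ¬ IsNonSeparating S δ :=
  fun hsep =>
    not_simplyConnectedSpace_of_reducing_nonseparating_of_fact h₂ o hS hc hess hd hsep ‹_›

end Trisection

end Literature.Topology.FourManifolds

end
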